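import Mathlib.Order.Filter.AtTopBot.Basic
import Mathlib.Topology.Instances.Real.Lemmas
import Literature.NumberTheory.EllipticCurves.OrdinaryPrimes
import Literature.NumberTheory.EllipticCurves.Isogeny
import HarnessLib

/-!
# Density of supersingular primes (Serre; Deuring) — infinitely many good ordinary primes

Trunk T-ELLARITH (Literature/NumberTheory/EllipticCurves); cite item `wi-03671` (route
BirchSwinnertonDyer/PAdicOrder #6, stmt-0140). Strengthens the grounder's fact
`WeierstrassCurve.exists_good_ordinary_prime` (`OrdinaryPrimes.lean`) from "some `p ≥ 5`" to
"infinitely many", and records the densities behind it.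

For an elliptic curve `E/ℚ` (globally minimal `W`, `a_p = frobeniusTrace W p`):
* no CM (Serre 1981, §8, Thm. 20 and Cor. 2, unconditional via Chebotarev with error terms):
  `#{p ≤ x : a_p = 0} ≪ x/(log x)^{5/4-ε}`, so the supersingular primes have natural density `0`
  and the good ordinary primes density `1`;
* CM by `K` (Deuring 1941): for `p ≥ 5` of good reduction, `p` is supersingular iff `p` is inert or
  ramified in `K`; both sets have density `1/2`.
Hence in all cases the set of good ordinary primes is infinite (indeed of positive density), which is
the shape the route consumes; Elkies 1987 (infinitely many supersingular primes) is context only.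

## Contents

* `goodOrdinaryPrimes W`, `goodSupersingularPrimes W : Set ℕ`; `primeCountingRatio S x`
  (`#{p ≤ x, p ∈ S} / π(x)`), `HasPrimeDensity S δ`.
* Named facts: `serre_supersingular_density_zero` (no CM ⇒ density `0`),
  `deuring_supersingular_density_half` (CM ⇒ density `1/2`),
  `infinite_goodOrdinaryPrimes` (all `E/ℚ`).
* Proved: `exists_good_ordinary_prime_of_infinite` — the infinite form implies the grounder's
  `exists_good_ordinary_prime`.

## Sources

* J.-P. Serre, *Quelques applications du théorème de densité de Chebotarev*, Publ. Math. IHÉS 54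
  (1981), §8, Thm. 20, Cor. 2.
* M. Deuring, Abh. Math. Sem. Hamburg 14 (1941).
* N. Elkies, *The existence of infinitely many supersingular primes for every elliptic curve over
  ℚ*, Invent. Math. 89 (1987).
-/

noncomputable section

open Filter Topology

namespace WeierstrassCurve

variable (W : WeierstrassCurve ℚ) [W.IsGloballyMinimal]

/-- The good ordinary primes of `W`: primes `p` of good reduction with `p ∤ a_p` (for `p ≥ 5`,
equivalently `a_p ≠ 0`, i.e. ordinary reduction). [Serre 1981, §8; Silverman AEC V.4] [cite: Serre1981, §8] -/
def goodOrdinaryPrimes : Set ℕ :=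
  {p | ∃ _ : Fact p.Prime, W.HasGoodReductionAtPrime p ∧ ¬ (p : ℤ) ∣ W.frobeniusTrace p}

/-- The good supersingular primes of `W`: primes `p` of good reduction with `p ∣ a_p` (for
`p ≥ 5`, equivalently `a_p = 0`). [Serre 1981, §8 (`a_p = 0`)] [cite: Serre1981, §8] -/
def goodSupersingularPrimes : Set ℕ :=
  {p | ∃ _ : Fact p.Prime, W.HasGoodReductionAtPrime p ∧ (p : ℤ) ∣ W.frobeniusTrace p}

variable {W}

omit [W.IsGloballyMinimal] in
/-- The relative counting function `#{p ≤ x : p ∈ S} / #{p ≤ x : p prime}` of a set of naturals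
against the primes (junk `0/0 = 0` for `x < 2`). [Serre 1981, §1 (natural density of a set of
primes)] [folklore] -/
def primeCountingRatio (S : Set ℕ) (x : ℕ) : ℝ :=
  (Nat.card {p : ℕ // p ≤ x ∧ p.Prime ∧ p ∈ S} : ℝ) / (Nat.card {p : ℕ // p ≤ x ∧ p.Prime} : ℝ)

omit [W.IsGloballyMinimal] in
/-- `S` has natural (prime) density `δ`: `#{p ≤ x ∈ S}/π(x) → δ`. [Serre 1981, §1] [folklore] -/
def HasPrimeDensity (S : Set ℕ) (δ : ℝ) : Prop :=
  Tendsto (primeCountingRatio S) atTop (𝓝 δ)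

/-! ### Named facts -/

/-- **Serre**: for `E/ℚ` WITHOUT complex multiplication the supersingular primes have natural
density `0` (indeed `#{p ≤ x : a_p = 0} ≪_ε x/(log x)^{5/4-ε}`, unconditionally).
[Serre 1981, §8, Thm. 20 and Cor. 2] [cite: Serre1981, §8 Thm. 20] -/
def serre_supersingular_density_zero : Prop :=
  ∀ (W : WeierstrassCurve ℚ) [W.IsElliptic] [W.IsGloballyMinimal], ¬ W.HasCM →
    HasPrimeDensity W.goodSupersingularPrimes 0

/-- **Deuring**: for `E/ℚ` WITH complex multiplication the supersingular primes have natural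
density `1/2` (they are, up to finitely many, the primes inert in the CM field).
[Deuring 1941; Serre 1981, §8 (remark)] [cite: Serre1981, §8] -/
def deuring_supersingular_density_half : Prop :=
  ∀ (W : WeierstrassCurve ℚ) [W.IsElliptic] [W.IsGloballyMinimal], W.HasCM →
    HasPrimeDensity W.goodSupersingularPrimes (1 / 2)

/-- **Infinitely many good ordinary primes** for every elliptic curve over `ℚ` (density `1`
without CM by Serre, `1/2` with CM by Deuring). The shape consumed by route PAdicOrder #6.
[Serre 1981, §8, Cor. 2; Deuring 1941] [cite: Serre1981, §8 Cor. 2] -/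
def infinite_goodOrdinaryPrimes : Prop :=
  ∀ (W : WeierstrassCurve ℚ) [W.IsElliptic] [W.IsGloballyMinimal], W.goodOrdinaryPrimes.Infinite

/-! ### API -/

/-- The infinite form implies the grounder's existence-of-one form (`OrdinaryPrimes.lean`): an
infinite set of naturals has an element `≥ 5`. [folklore] -/
theorem exists_good_ordinary_prime_of_infinite (h : infinite_goodOrdinaryPrimes) :
    exists_good_ordinary_prime := by
  intro W _ _
  obtain ⟨p, ⟨hp, hgood, hnd⟩, h5⟩ := (h W).exists_gt 4
  exact ⟨p, hp, h5, hgood, hnd⟩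

/-- Good ordinary and good supersingular primes are disjoint. [folklore] -/
theorem disjoint_goodOrdinaryPrimes_goodSupersingularPrimes (W : WeierstrassCurve ℚ)
    [W.IsGloballyMinimal] : Disjoint W.goodOrdinaryPrimes W.goodSupersingularPrimes := by
  rw [Set.disjoint_left]
  rintro p ⟨_, -, hnd⟩ ⟨_, -, hd⟩
  exact hnd hd

end WeierstrassCurve
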